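import Literature.MathematicalPhysics.QuantumFieldTheory.Balaban1983to89.B9Eq342SupNormBootstrap

/-!
# `Balaban1983to89.B9Eq342SupNormBootstrapLinf` — T. Bałaban, *Propagators for lattice gauge theories in a background field*, Commun. Math. Phys. **99**
# (1985) 389–434 [Balaban1985BackgroundPropagators] Thm 3.1 (3.42) p. 397 with (3.10) p. 392, (3.26) p. 395 and the regularity class (3.35) p. 396:
# **THE KATO BOOTSTRAP WITH AN `L^∞ → L^∞` PERTURBATION LETTER — for `(L + P)u = f` with `L` of Kato form and a non-Kato part bounded POINTWISE BY THE
# SUP NORM ITSELF, `‖(Pu)(x)‖ ≤ p_∞·sup_y‖u(y)‖ + R`, `2p_∞ < m`: `sup_x‖u(x)‖ ≤ (2(F + R)∕m + m²·C₃·‖u‖_{L²(c)})∕(1 − 2p_∞∕m)`** — stone (A0) of the NE9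
# owner's plan v11 («storey G₁ by Woodbury around the local part», `t4/b2b-balaban-t4-ne9-p1/g91/PLAN-V11-STOREY-G1.md` §1): the LOCAL part
# `A₀ = Δ(U) + D_UD*_U + aQ*Q` of print's `Δ_a` (3.26) is the covariant BOND Laplacian (Kato form) plus the curvature∕Weitzenböck remainder of (3.10), an operator
# of size `O(α₀)` on print's class (3.35) in the SUP norm — it rides in the letter `p_∞`; the block-local penalty and the source ride in `R`, `F` as in plan v10

statement-level skeleton of published theorems with citation tags; proofs where landed; nothing here is a claim about the Yang–Mills mass gap

CITATION HEADER (lean-in-tree rule).  Audit cell `pub-balaban`, sub-cell `t4`, BINDER row NE9; filed by the NE9 BINDER-row OWNER lineage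
`b2b-balaban-t4-ne9-p1` (gen 91).  A corollary BY NAME of this lineage's g89 `B9Eq342SupNormBootstrap.norm_le_of_kato_bootstrap` (Kato domination used twice,
[DodziukMathai2006] §1) — the displayed number `Pq` there is allowed to depend on `sup‖u‖` and the resulting inequality is solved for the sup.  Sources READ
first-hand (`paper:balaban1985-cmp99-background-propagators`): p. 392 (3.10), p. 395 (3.26), p. 396 (3.35)–(3.36), p. 397 Thm 3.1.

WHAT IS PROVED (sorry-free; proof lane — no `def`; [folklore] one rearrangement).
* **`norm_le_of_kato_bootstrap_linf`**: letters as `norm_le_of_kato_bootstrap` (weighted graph `nbr, w ≥ 0`, contractions `T`, mass `m > 0`, the flat double-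
  resolvent letter `C₃`, the Kato form `hu` of `(L+P)u = f`), data `‖f(x)‖ ≤ F` and the PERTURBATION LETTER `‖q(x)‖ ≤ p_∞·(⨆_y ‖u(y)‖) + R` with
  `2p_∞ < m`: for every `x`, `‖u(x)‖ ≤ (2(F + R)∕m + m²C₃·√(Σ_y c_y‖u(y)‖²))∕(1 − 2p_∞∕m)`.
HONEST SCOPE.  A two-line rearrangement; the letter `p_∞ = O(α₀)` of (3.10)'s curvature part on (3.35) is NOT derived here (plan v11 stone (K0)); nothing of
[B9] asserted; «NE9 ⇐ the named binders»; NE9 NOT PRINTED ∕ NOT PROVED; row WALLED ON A MODEL (O-NE9-1; NEEDS-COORDINATOR #5 UNRULED); spine PROVED 0∕9;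
rung (B)+1 on a finite T⁴ — NOT infinite volume, NOT mass gap, NOT BetaPertH, NOT Clay.  HONEST DEPENDENCY: continuum YM on T⁴ ⇐ BetaPertH ∧ nine spine
estimates (0/9 proved); BetaPertH ⇐ (D1) ∧ (D4) ∧ CAP+tail; G-an2-4 gates asym, D1 and NE2/3/4.  NEW file; nothing modified.  Net new unproved facts: 0.
-/

noncomputable section

open scoped BigOperators

namespace Literature.MathematicalPhysics.QuantumFieldTheory.Balaban1983to89.B9Eq342SupNormBootstrapLinf

open B9Eq342SupNormBootstrap (norm_le_of_kato_bootstrap)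

variable {𝕜 : Type*} [RCLike 𝕜] {V : Type*} [NormedAddCommGroup V] [InnerProductSpace 𝕜 V]
  {ι J : Type*} [Fintype J] [Fintype ι]

/-- **THE KATO BOOTSTRAP WITH AN `L^∞ → L^∞` PERTURBATION LETTER**: if `(L + P)u = f` in Kato form (`hu`), `‖f(x)‖ ≤ F`, and the non-Kato part obeys
`‖q(x)‖ ≤ p_∞·(⨆_y ‖u(y)‖) + R` with `2p_∞ < m`, then `‖u(x)‖ ≤ (2(F + R)∕m + m²·C₃·√(Σ_y c_y‖u(y)‖²))∕(1 − 2p_∞∕m)` for every `x` —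
`norm_le_of_kato_bootstrap` at `Pq := p_∞·sup‖u‖ + R`, read at a maximiser and solved for the sup (the curvature∕Weitzenböck part of the bond Hessian (3.10),
`O(α₀)` on print's class (3.35), is such a `P`). [cite: Balaban1985BackgroundPropagators, Thm 3.1 (3.42) p.397, (3.10) p.392, (3.26) p.395, (3.35) p.396; DodziukMathai2006, Lemma 1.1 §1] -/
theorem norm_le_of_kato_bootstrap_linf (nbr : ι → J → ι) (w : ι → J → ℝ) (hw : ∀ x j, 0 ≤ w x j) (T : ι → J → V →ₗ[𝕜] V)
    (hT : ∀ x j v, ‖T x j v‖ ≤ ‖v‖) (c : ι → ℝ) {m C₃ : ℝ} (hm : 0 < m)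
    (hFS : ∀ ψ φ₁ φ₂ : ι → ℝ, (∀ x, 0 ≤ ψ x) → (∀ x, ∑ j, w x j * (φ₁ x - φ₁ (nbr x j)) + m * φ₁ x = ψ x) →
      (∀ x, ∑ j, w x j * (φ₂ x - φ₂ (nbr x j)) + m * φ₂ x = φ₁ x) → ∀ x, φ₂ x ≤ C₃ * Real.sqrt (∑ y, c y * ψ y ^ 2))
    {u f q : ι → V} (hu : ∀ x, ∑ j, (w x j : 𝕜) • (u x - T x j (u (nbr x j))) = f x - q x)
    {F pinf R : ℝ} (hF : ∀ x, ‖f x‖ ≤ F) (hpm : 2 * pinf < m)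
    (hq : ∀ x, ‖q x‖ ≤ pinf * (⨆ y, ‖u y‖) + R) (x : ι) :
    ‖u x‖ ≤ (2 * (F + R) / m + m ^ 2 * C₃ * Real.sqrt (∑ y, c y * ‖u y‖ ^ 2)) / (1 - 2 * pinf / m) := by
  haveI : Nonempty ι := ⟨x⟩
  set S : ℝ := ⨆ y, ‖u y‖
  have hbdd : BddAbove (Set.range fun y => ‖u y‖) := (Set.finite_range _).bddAbove
  have hS : ∀ y, ‖u y‖ ≤ S := fun y => le_ciSup hbdd y
  -- the bootstrap at the displayed number `Pq := p_∞ S + R`, at every site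
  have key : ∀ y, ‖u y‖ ≤ 2 * (F + (pinf * S + R)) / m + m ^ 2 * C₃ * Real.sqrt (∑ y, c y * ‖u y‖ ^ 2) := fun y =>
    norm_le_of_kato_bootstrap nbr w hw T hT c hm hFS hu hF hq y
  -- hence the sup obeys the same bound, which is solved for it
  have hSle : S ≤ 2 * (F + (pinf * S + R)) / m + m ^ 2 * C₃ * Real.sqrt (∑ y, c y * ‖u y‖ ^ 2) := ciSup_le key
  have hden : 0 < 1 - 2 * pinf / m := by
    rw [sub_pos, div_lt_one hm]; exact hpm
  have hsolve : S ≤ (2 * (F + R) / m + m ^ 2 * C₃ * Real.sqrt (∑ y, c y * ‖u y‖ ^ 2)) / (1 - 2 * pinf / m) := by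
    rw [le_div_iff₀ hden]
    have e : 2 * (F + (pinf * S + R)) / m = 2 * (F + R) / m + 2 * pinf / m * S := by ring
    rw [e] at hSle
    nlinarith
  exact (hS x).trans hsolve

end Literature.MathematicalPhysics.QuantumFieldTheory.Balaban1983to89.B9Eq342SupNormBootstrapLinf

end
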